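import Summits.BirchSwinnertonDyer.BirchSwinnertonDyer.Theorems.ByReductionTypeAtTwoRankOneAtTwoOffBigImageOddLocalEngineChiKernelAtTwo
import Summits.BirchSwinnertonDyer.BirchSwinnertonDyer.Theorems.SylvesterTwoHeegnerIndexUpperOffV0LocalCriterionOfKerChi
import HarnessLib

/-!
# Route `ByReductionTypeAtTwo`, crux `RankOneAtTwoOffBigImageOddLocal` (stmt-BirchSwinnertonDyer-23716), line
# `refined_kolyvagin_tamagawa_shift_at_two` — ENGINE PORT, card E4-γ: McCallum's Prop. 4.4 SHELL (the local KOLYVAGIN RELATION at `λ ∣ ℓ`) WITHOUT `p ≠ 2`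

Lead prover `prover-cruxlead-stmt-BirchSwinnertonDyer-23716-g2` (2026-08-28).  The tree's
`Literature.NumberTheory.EllipticCurves.zsmul_kolyvaginClass_mem_selmerLocalKer_iff_mem_torsionLocalKer` (file
`HeegnerPointsKolyvaginPrimaryRamifiedProofs`, McCallum 1991 Prop. 4.4 / Gross 1991 Prop. 6.2 (2) in order form: «`k c_M(mℓ)` is Selmer at
`λ` iff `k c_M(m)_λ = 0`», from an abstract reduction datum at `λ`) carries the printed hypothesis `p ≠ 2`, but uses it in exactly ONE place:
the finite-group identity «`ker χ_ℓ = p^M Ẽ(F_λ)`» (`KolyvaginChi.sub_eq_zero_iff_exists_pow_zsmul_eq`, via `±`-eigen-decomposition).  The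
tree already has the shell with that identity taken as an abstract input `hχ` (any prime `p`; `SylvesterTwoUpper.…_of_kerChi`, cell bsd-cm, file
`Theorems/SylvesterTwoHeegnerIndexUpperOffV0LocalCriterionOfKerChi.lean`, where `hχ` at `2` is left UNPROVED); this file DISCHARGES `hχ` at `p = 2`
from the supplies of `…EngineChiKernelAtTwo.lean`
(`KolyvaginChiTwo.sub_eq_zero_iff_exists_zsmul_eq_of_isCoprime` — unequal valuations `v₂(a_ℓ) ≠ v₂(ℓ+1)`, any Frobenius —, and
`KolyvaginChiTwo.sub_eq_zero_iff_exists_pow_zsmul_eq_of_relations` — equal valuations, REGULAR = `ℤ[Frob]`-cyclic `Ẽ(𝔽_{ℓ²})[2^∞]`).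
This is the local core of the sibling route's crux `KolyvaginRelationAtTwo` (stmt-BirchSwinnertonDyer-24880, «McCallum Prop. 4.4 with `p := 2`»)
modulo the same abstract reduction datum the tree's odd-`p` theorem is stated over, and the (γ)-consumer
`zsmul_kolyvaginClass_mem_selmerLocalKer_iff_of_isKolyvaginPrime` of the line card's E4 inventory with its `p ≠ 2` removed.

* `kerChi_two_of_isCoprime` — `hχ` at `p = 2` in the shell's `B`-form, coprime case `2^M ⊥ a'² - l'²` (every sharp prime, every `a_ℓ = 0` prime —
  in particular the Sylvester lane's `a_ℓ = 0` «free-module mechanism»; ANY Frobenius type), with `Ẽ(F_λ) = {φ² = 1}` finite.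
* `zsmul_kolyvaginClass_mem_selmerLocalKer_iff_mem_torsionLocalKer_two_of_isCoprime` — McCallum Prop. 4.4 at `λ` for `p = 2`, coprime case,
  from the abstract reduction datum: NO `p ≠ 2`, NO eigen-cyclicity.

Nothing here proves the crux, `BSDp W 2`, BSD or the summit; no registered stub is discharged.  BSD is not proved.

Refs: [McCallumLMS1991] §4 Lemma 4.3, Prop. 4.4 and proof; [GrossLMS1991] §6 Prop. 6.2 (2); [KolyvaginEulerSystems1990] Thm. 3.
-/

set_option linter.dupNamespace false -- tree convention: `Summit.BirchSwinnertonDyer.BirchSwinnertonDyer.Theorems` (summit = sub-problem)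
set_option autoImplicit false

noncomputable section

namespace Summit.BirchSwinnertonDyer.BirchSwinnertonDyer.Theorems.OffBigImageOddLocalAtTwo.Engine

open scoped Classical
open WeierstrassCurve NumberField IsDedekindDomain Field Finset
open Literature.NumberTheory.GaloisRepresentations Literature.NumberTheory.EllipticCurves
open Literature.NumberTheory.EllipticCurves.KolyvaginCocycle

universe u

section RamifiedAnyP

variable {K : Type u} [Field K] [NumberField K] (W : WeierstrassCurve K) [W.IsElliptic]

/-- **`ker χ_ℓ = 2^M Ẽ(F_λ)` in the shell's `B`-form, coprime case.**  For an additive `φ` on `B` with `B₀ = {φ² = 1}` finite, the characteristic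
relation `(ℓ+1) b = a φ(b)` on `B₀` with `ℓ + 1 = 2^M l'`, `a = 2^M a'`, and `2^M` coprime to `a'² - l'²`: for every `b ∈ B₀`,
`a' b - l' φ(b) = 0 ↔ ∃ y ∈ B₀, 2^M y = b`.  This is exactly the hypothesis `hχ` of
`SylvesterTwoUpper.zsmul_kolyvaginClass_mem_selmerLocalKer_iff_mem_torsionLocalKer_of_kerChi` at `p = 2` (and, at `a_ℓ = 0`, the «free-module
mechanism» that file leaves unproved: `a' = 0`, `l'` odd), obtained from `KolyvaginChiTwo.sub_eq_zero_iff_exists_zsmul_eq_of_isCoprime` on the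
finite group `B₀`. [cite: McCallumLMS1991, Prop. 4.4 (2)] -/
theorem kerChi_two_of_isCoprime {B : Type*} [AddCommGroup B] (φ : B →+ B) (hfin : Set.Finite {b : B | φ (φ b) = b})
    {M ℓ : ℕ} {a l' a' : ℤ} (hl' : ((ℓ + 1 : ℕ) : ℤ) = (2 : ℤ) ^ M * l') (ha' : a = (2 : ℤ) ^ M * a')
    (hchar : ∀ b : B, φ (φ b) = b → ((ℓ + 1 : ℕ) : ℤ) • b = a • φ b)
    (hcop : IsCoprime ((2 : ℤ) ^ M) (a' ^ 2 - l' ^ 2)) (b : B) (hb : φ (φ b) = b) :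
    a' • b - l' • φ b = 0 ↔ ∃ y : B, φ (φ y) = y ∧ ((2 : ℤ) ^ M) • y = b := by
  set φ2 : B →+ B := φ.comp φ with hφ2def
  set B₀ : AddSubgroup B := φ2.eqLocus (AddMonoidHom.id B) with hB₀def
  have hmemB₀ : ∀ {c : B}, c ∈ B₀ ↔ φ (φ c) = c := fun {c} ↦ Iff.rfl
  haveI : Finite B₀ := by
    have : {c : B | φ (φ c) = c}.Finite := hfin
    exact Set.finite_coe_iff.mpr this
  have hφB₀ : ∀ c ∈ B₀, φ c ∈ B₀ := fun c hc ↦ by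
    rw [hmemB₀] at hc ⊢
    rw [hc]
  set φ₀ : B₀ →+ B₀ := (φ.comp B₀.subtype).codRestrict B₀ (fun c ↦ hφB₀ c c.2) with hφ₀def
  have hφ₀ : ∀ c : B₀, (φ₀ c : B) = φ c := fun c ↦ rfl
  have hφ₀inv : ∀ c : B₀, φ₀ (φ₀ c) = c := fun c ↦ Subtype.ext (by rw [hφ₀, hφ₀]; exact c.2)
  have hchar₀ : ∀ c : B₀, ((2 : ℤ) ^ M * l') • c = ((2 : ℤ) ^ M * a') • φ₀ c := fun c ↦ by
    apply Subtype.ext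
    rw [AddSubgroupClass.coe_zsmul, AddSubgroupClass.coe_zsmul, hφ₀, ← hl', ← ha']
    exact hchar c c.2
  have key := KolyvaginChiTwo.sub_eq_zero_iff_exists_zsmul_eq_of_isCoprime φ₀ hφ₀inv hchar₀ hcop ⟨b, hmemB₀.mpr hb⟩
  rw [Subtype.ext_iff, AddSubgroupClass.coe_sub, AddSubgroupClass.coe_zsmul, AddSubgroupClass.coe_zsmul, hφ₀,
    AddSubgroup.coe_zero] at key
  rw [key]
  constructor
  · rintro ⟨y, hy⟩
    exact ⟨y, hmemB₀.mp y.2, by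
      have h := congrArg Subtype.val hy
      rwa [AddSubgroupClass.coe_zsmul] at h⟩
  · rintro ⟨y, hy, hyb⟩
    exact ⟨⟨y, hmemB₀.mpr hy⟩, Subtype.ext (by rw [AddSubgroupClass.coe_zsmul]; exact hyb)⟩

/-- **McCallum Prop. 4.4 at `p = 2`, coprime case (`v₂(a_ℓ) ≠ v₂(ℓ+1)`: every sharp prime, every `a_ℓ = 0` prime; ANY Frobenius type).**
Same abstract reduction datum at `λ` as the tree's odd-`p` theorem, with `p := 2`, `ℓ + 1 = 2^M l'`, `a = a_ℓ = 2^M a'`, the characteristic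
relation `(ℓ+1) b = a φ(b)` on `Ẽ(F_λ) = {φ² = 1}` (finite), and `2^M` coprime to `a'² - l'²` in place of the eigen-cyclicity `hcyc`: then for every
`k ∈ ℤ`, `k c_M(mℓ)` is Selmer at `λ` iff `k c_M(m)_λ = 0`.  Proof: the tree's `p`-free shell `SylvesterTwoUpper.zsmul_kolyvaginClass_mem_selmerLocalKer_iff_mem_torsionLocalKer_of_kerChi` (cell bsd-cm, which isolated
the `p ≠ 2` step as the hypothesis `hχ`) with `hχ` DISCHARGED by `kerChi_two_of_isCoprime`.  No eigenvectors, no `p ≠ 2`.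
[cite: McCallumLMS1991, Prop. 4.4] [cite: GrossLMS1991, Prop. 6.2 (2)] -/
theorem zsmul_kolyvaginClass_mem_selmerLocalKer_iff_mem_torsionLocalKer_two_of_isCoprime
    {M : ℕ}
    {hdiv : ∀ P : geomPoints W, ∃ Q : geomPoints W, ((2 ^ M : ℕ) : ℤ) • Q = P}
    {A₁ A₂ : AddSubgroup (geomPoints W)}
    (hA₁ : IsAdmissible (absoluteGaloisGroup K) A₁ ((2 ^ M : ℕ) : ℤ))
    (hA₂ : IsAdmissible (absoluteGaloisGroup K) A₂ ((2 ^ M : ℕ) : ℤ))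
    {P₁ P₂ : geomPoints W}
    (hP₁ : P₁ ∈ invPoints (absoluteGaloisGroup K) A₁ ((2 ^ M : ℕ) : ℤ))
    (hP₂ : P₂ ∈ invPoints (absoluteGaloisGroup K) A₂ ((2 ^ M : ℕ) : ℤ))
    -- the place `λ`
    {v : HeightOneSpectrum (𝓞 K)} (hgood : W.HasGoodReductionAt v) (hpv : (2 : 𝓞 K) ∉ v.asIdeal)
    {𝔐 : Ideal (HeightOneSpectrum.localAbsIntegers v)} (h𝔐 : 𝔐 ∈ v.localPrimesAbove)
    {F : absoluteGaloisGroup K}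
    (hF : IsArithFrobAt (𝓞 K) F (v.primeBelow (closureEmb (K := K) (v.adicCompletion K)) 𝔐))
    (hFfix : F ∈ torsionFixing W ((2 ^ M : ℕ) : ℤ))
    (hsurj : Function.Surjective (torsionPointsMap W (v.adicCompletion K) ((2 ^ M : ℕ) : ℤ)))
    -- the reduction datum at `𝔓`
    {B : Type*} [AddCommGroup B] (red : geomPoints W →+ B) (φ : B →+ B)
    (hredI : ∀ τ ∈ (v.primeBelow (closureEmb (K := K) (v.adicCompletion K)) 𝔐).inertia
      (absoluteGaloisGroup K), ∀ x : geomPoints W, red (τ • x) = red x)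
    (hredF : ∀ x : geomPoints W, red (F • x) = φ (φ (red x)))
    (hred : ∀ x : geomPoints W, ((2 ^ M : ℕ) : ℤ) • x = 0 → red x = 0 → x = 0)
    (hBn : ∀ b : B, ((2 ^ M : ℕ) : ℤ) • b = 0 → φ (φ b) = b)
    -- the arithmetic of `Ẽ(F_λ) = {φ² = 1}` (finite), coprime case
    (hfin : Set.Finite {b : B | φ (φ b) = b})
    {ℓ : ℕ} {a l' a' : ℤ} (hl' : ((ℓ + 1 : ℕ) : ℤ) = (2 : ℤ) ^ M * l')
    (ha' : a = (2 : ℤ) ^ M * a')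
    (hchar : ∀ b : B, φ (φ b) = b → ((ℓ + 1 : ℕ) : ℤ) • b = a • φ b)
    (hcop : IsCoprime ((2 : ℤ) ^ M) (a' ^ 2 - l' ^ 2))
    -- the Euler-system data at `λ`
    {τ₀ : absoluteGaloisGroup K}
    (hτ₀ : τ₀ ∈ (v.primeBelow (closureEmb (K := K) (v.adicCompletion K)) 𝔐).inertia
      (absoluteGaloisGroup K))
    (hIτ₀ : ∀ τ ∈ (v.primeBelow (closureEmb (K := K) (v.adicCompletion K)) 𝔐).inertia
      (absoluteGaloisGroup K), ∃ i : ℕ, ∀ x ∈ A₁, τ • x = (τ₀ ^ i) • x)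
    {R₀ : geomPoints W} (hR₀A : R₀ ∈ A₁) (hR₀ : ((2 ^ M : ℕ) : ℤ) • R₀ = τ₀ • P₁ - P₁)
    (hR₀red : red R₀ = l' • φ (red P₂) - a' • red P₂)
    (hFP₂ : F • P₂ = P₂)
    (hsel₂ : kolyvaginClass W _ hdiv hA₂ P₂ hP₂ ∈
      selmerLocalKer W (v.adicCompletion K) ((2 ^ M : ℕ) : ℤ))
    (k : ℤ) :
    k • kolyvaginClass W _ hdiv hA₁ P₁ hP₁ ∈ selmerLocalKer W (v.adicCompletion K) ((2 ^ M : ℕ) : ℤ) ↔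
      k • kolyvaginClass W _ hdiv hA₂ P₂ hP₂ ∈
        W.torsionLocalKer (v.adicCompletion K) ((2 ^ M : ℕ) : ℤ) := by
  exact SylvesterTwoUpper.zsmul_kolyvaginClass_mem_selmerLocalKer_iff_mem_torsionLocalKer_of_kerChi W Nat.prime_two
    hA₁ hA₂ hP₁ hP₂ hgood hpv h𝔐 hF hFfix hsurj red φ hredI hredF hred hBn
    (fun b hb ↦ kerChi_two_of_isCoprime φ hfin hl' ha' hchar hcop b hb) hτ₀ hIτ₀ hR₀A hR₀ hR₀red hFP₂ hsel₂ k

end RamifiedAnyP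

end Summit.BirchSwinnertonDyer.BirchSwinnertonDyer.Theorems.OffBigImageOddLocalAtTwo.Engine

end
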